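import Literature.NumberTheory.Transcendental.PadicCW77Setup
import Literature.NumberTheory.Transcendental.Waldschmidt1980Delta
import Mathlib.Analysis.Calculus.Deriv.Polynomial
import Mathlib.Analysis.Calculus.IteratedDeriv.Lemmas
import HarnessLib

/-!
# The `p`-adic Cijsouw–Waldschmidt auxiliary functions `f_{J,τ}`, `φ_{J,τ}` over `ℚ_p`

Support file (definitions and proved theorems; no named fact), sequel to `PadicCW77Setup.lean`
(cell `abc-stewartyu`, WP-A2). For `S : PadicCW77.Setup` (odd prime `p`, principal units
`αⱼ, θ ≡ 1 (mod p)`), at level `J` of the `2`-descent with finest level `J₀`, for a finite set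
`box` of unknowns `u = (ρ, λ, λ_θ)` with integer values `p(u)` and a multi-order `τ = (τ₀, τ')`:

* `wOf J₀ J u ∈ ℚ_p[X]` — the `Δ`-polynomial `w_ρ(2^{J₀−J} X)` (the image of the tree's rational
  `Waldschmidt1980.wScaled`, cf. `Waldschmidt1980.map_wScaled`), `Dw … τ₀ z = (d/dz)^{τ₀} w (z)`; at a natural number `s` its value
  is the frame's rational `qΔ` (`Dw_natCast`, transported from the complex identity
  `CW77.Setup.Qw_wOf_natCast` through `ℚ`);
* `termF u τ z = Dw τ₀ z · A(u,τ') · exp(expo(u) z)`, `termΦ` the same with the exact exponent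
  `ψ_u`, `F = ∑ p(u) termF` (`f_{J,τ}`), `Φ = ∑ p(u) termΦ` (`φ_{J,τ}`) — functions `ℚ_p → ℚ_p`,
  analytic on `‖z‖ < √p ` (`‖expo u‖ ≤ p⁻¹` and the exponential converges on `‖·‖ < p^{-1/2}`);
* `hasDerivAt_F` — the differential equations `f'_{τ} = f_{τ+e₀} + ∑ⱼ (log_p αⱼ) f_{τ+eⱼ}`
  on `‖z‖ < √p`; `norm_iteratedDeriv_F_le_of_forall` — **derivatives are controlled by values**
  WITHOUT LOSS (ultrametric, `‖log_p αⱼ‖ ≤ 1`): if `‖f_{τ'}(a)‖ ≤ ε` for `|τ'| ≤ N` then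
  `‖f_τ^{(k)}(a)‖ ≤ ε` for `|τ| + k ≤ N`;
* `Φ_natCast` — `φ_{J,τ}(s) = coreSum ∈ ℚ` at a natural number `s`;
* `norm_F_le` — `‖f_{J,τ}(z)‖ ≤ Q` on `‖z‖ ≤ 1` (`Q ≥ ‖Dw‖`; the `p(u)` are integers, `‖A‖ ≤ 1`,
  `‖exp‖ = 1`: NO growth factor, in contrast with the archimedean `e^{Ψ|z|}`);
* `norm_F_sub_Φ_le` — **Lemma 9, ultrametric**: `‖f − φ‖ ≤ Q · ‖Λ₀‖` on `‖z‖ ≤ 1` when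
  `‖Λ₀‖ ≤ p⁻¹` (`‖exp w − 1‖ = ‖w‖`; `Λ₀ = −Λ/b_θ`).

## References
* [Yu1990] K. Yu, *Linear forms in p-adic logarithms II*, Compositio Math. 74 (1990), §§2–3.
* [CijsouwWaldschmidt1977] P. L. Cijsouw, M. Waldschmidt, Compositio Math. 34 (1977), §4
  (pp. 184–188: the functions, Lemma 9, the differential equations).
-/

noncomputable section

open NormedSpace Finset IsUltrametricDist Polynomial Metric
open Literature.NumberTheory.Transcendental.Baker1975 (bump bump_apply sum_bump)
open Literature.NumberTheory.Transcendental.Baker1975.Ch3 (wPoly Qw)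
open scoped Nat Topology

namespace Literature.NumberTheory.Transcendental

namespace PadicCW77

open CW77.Setup (Idx Tau tauNorm bump0 bumpj bumpτ tauNorm_bumpτ bumpτ_zero bumpτ_succ Qw_zero_right)

namespace Setup

variable (S : Setup) {h Lb : ℕ}

/-! ### The `Δ`-polynomial and its rational values -/

/-- The rational value factor `(d/dX)^{k} [w_{a,b}(cX)] (x) ∈ ℚ` (`w_{a,b} = Δ(X;a)Δ(X;h)ᵇ`).
[cite: CijsouwWaldschmidt1977, §4 (9) (p. 184)] -/
def DwQ (c a b h k : ℕ) (x : ℚ) : ℚ := (derivative^[k] (Waldschmidt1980.wScaled c a b h)).eval x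

/-- **The rational identity** `DwQ (2^{J₀−J}) r l h τ₀ s = qΔ` (transported from the complex
identity `CW77.Setup.Qw_wOf_natCast` of the frame through `ℚ ↪ ℂ`).
[cite: CijsouwWaldschmidt1977, §4 (9) (p. 184)] -/
theorem DwQ_eq_qΔ (J₀ J : ℕ) (u : Idx S.d h Lb) (τ₀ s : ℕ) :
    DwQ (2 ^ (J₀ - J)) (u.1.1 : ℕ) (u.1.2 : ℕ) h τ₀ (s : ℚ) = S.frame.qΔ J₀ J u τ₀ s := by
  apply Rat.cast_injective (α := ℂ)
  have h1 := S.frame.Qw_wOf_natCast J₀ J u τ₀ s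
  rw [Qw_zero_right] at h1
  rw [← h1]
  unfold DwQ CW77.Setup.wOf
  rw [← Waldschmidt1980.map_wScaled, iterate_derivative_map, Polynomial.eval_map,
    Polynomial.eval₂_at_natCast]
  simp

/-- **The `Δ`-polynomial of `u` at level `J`** over `ℚ_p`: `w_ρ(2^{J₀−J} X) ∈ ℚ_p[X]`.
[cite: CijsouwWaldschmidt1977, §4 (p. 186)] -/
def wOf (J₀ J : ℕ) (u : Idx S.d h Lb) : ℚ_[S.p][X] :=
  (Waldschmidt1980.wScaled (2 ^ (J₀ - J)) (u.1.1 : ℕ) (u.1.2 : ℕ) h).map (algebraMap ℚ ℚ_[S.p])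

/-- The `Δ`-factor `Dw τ₀ z = (d/dz)^{τ₀} [w_ρ(2^{J₀−J} z)]`. [cite: CijsouwWaldschmidt1977, §4 (p. 186)] -/
def Dw (J₀ J : ℕ) (u : Idx S.d h Lb) (τ₀ : ℕ) (z : ℚ_[S.p]) : ℚ_[S.p] :=
  (derivative^[τ₀] (S.wOf J₀ J u)).eval z

/-- **`Dw τ₀ s = qΔ`** at a natural number `s`. [cite: CijsouwWaldschmidt1977, §4 (9) (p. 184)] -/
theorem Dw_natCast (J₀ J : ℕ) (u : Idx S.d h Lb) (τ₀ s : ℕ) :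
    S.Dw J₀ J u τ₀ (s : ℚ_[S.p]) = (S.frame.qΔ J₀ J u τ₀ s : ℚ_[S.p]) := by
  rw [← S.DwQ_eq_qΔ]
  unfold Dw wOf DwQ
  rw [iterate_derivative_map, Polynomial.eval_map,
    show ((s : ℕ) : ℚ_[S.p]) = algebraMap ℚ ℚ_[S.p] (s : ℚ) by simp, Polynomial.eval₂_at_apply]
  rfl

/-- **`Dw τ₀ x = DwQ … x`** at any RATIONAL point `x` (e.g. the half-integers `s/2` of the
descent: the `Δ`-factor takes rational values there). [cite: CijsouwWaldschmidt1977, §4 (p. 189)] -/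
theorem Dw_ratCast (J₀ J : ℕ) (u : Idx S.d h Lb) (τ₀ : ℕ) (x : ℚ) :
    S.Dw J₀ J u τ₀ (x : ℚ_[S.p]) = (DwQ (2 ^ (J₀ - J)) (u.1.1 : ℕ) (u.1.2 : ℕ) h τ₀ x : ℚ_[S.p]) := by
  unfold Dw wOf DwQ
  rw [iterate_derivative_map, Polynomial.eval_map,
    show ((x : ℚ) : ℚ_[S.p]) = algebraMap ℚ ℚ_[S.p] x from rfl, Polynomial.eval₂_at_apply]
  rfl

/-- `d/dz Dw τ₀ = Dw (τ₀+1)`. [cite: CijsouwWaldschmidt1977, §4 (pp. 186–188)] -/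
theorem hasDerivAt_Dw (J₀ J : ℕ) (u : Idx S.d h Lb) (τ₀ : ℕ) (z : ℚ_[S.p]) :
    HasDerivAt (S.Dw J₀ J u τ₀) (S.Dw J₀ J u (τ₀ + 1) z) z := by
  unfold Dw
  rw [Function.iterate_succ_apply']
  exact Polynomial.hasDerivAt _ z

/-! ### The functions -/

/-- `A(u, τ') = ∏ⱼ γⱼ^{τ'ⱼ} ∈ ℚ_p`. [cite: CijsouwWaldschmidt1977, §4 (p. 185)] -/
def A (u : Idx S.d h Lb) (τ' : Fin S.d → ℕ) : ℚ_[S.p] := ∏ j, (S.frame.γ u j : ℚ_[S.p]) ^ τ' j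

/-- `A = qA` (cast). [cite: CijsouwWaldschmidt1977, §4 (pp. 186–188)] -/
theorem A_eq (u : Idx S.d h Lb) (τ' : Fin S.d → ℕ) : S.A u τ' = (S.frame.qA u τ' : ℚ_[S.p]) := by
  unfold A CW77.Setup.qA; push_cast; rfl

/-- `‖A(u,τ')‖ ≤ 1`. [cite: CijsouwWaldschmidt1977, §4 (pp. 186–188)] -/
theorem norm_A_le (u : Idx S.d h Lb) (τ' : Fin S.d → ℕ) : ‖S.A u τ'‖ ≤ 1 := by
  rw [S.A_eq]; exact S.norm_qA_le u τ'

/-- `A(u, τ' + eⱼ) = A(u, τ') · γⱼ`. [cite: CijsouwWaldschmidt1977, §4 (pp. 186–188)] -/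
theorem A_bump (u : Idx S.d h Lb) (τ' : Fin S.d → ℕ) (j : Fin S.d) :
    S.A u (bump τ' j) = S.A u τ' * (S.frame.γ u j : ℚ_[S.p]) := by
  unfold A
  have hj : ∀ j' : Fin S.d, (S.frame.γ u j' : ℚ_[S.p]) ^ bump τ' j j' =
      (S.frame.γ u j' : ℚ_[S.p]) ^ τ' j' * (if j' = j then (S.frame.γ u j : ℚ_[S.p]) else 1) := by
    intro j'
    rw [bump_apply, pow_add]
    congr 1
    by_cases hjj : j' = j
    · subst hjj; simp
    · rw [if_neg hjj, if_neg hjj, pow_zero]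
  simp_rw [hj]
  rw [prod_mul_distrib, prod_ite_eq' univ j, if_pos (mem_univ j)]

/-- One term of `f_{J,τ}`: `Dw τ₀ z · A(u,τ') · exp(expo(u) z)`. [cite: CijsouwWaldschmidt1977, §4 (p. 186)] -/
def termF (J₀ J : ℕ) (u : Idx S.d h Lb) (τ : Tau S.d) (z : ℚ_[S.p]) : ℚ_[S.p] :=
  S.Dw J₀ J u τ.1 z * S.A u τ.2 * exp (S.expo u * z)

/-- One term of `φ_{J,τ}`: the same with the exact exponent `ψ_u`. [cite: CijsouwWaldschmidt1977, §4 (p. 186)] -/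
def termΦ (J₀ J : ℕ) (u : Idx S.d h Lb) (τ : Tau S.d) (z : ℚ_[S.p]) : ℚ_[S.p] :=
  S.Dw J₀ J u τ.1 z * S.A u τ.2 * exp (S.ψ u * z)

/-- **`f_{J,τ}(z) = ∑_{u ∈ box} p(u) · termF`**. [cite: CijsouwWaldschmidt1977, §4 (p. 186)] -/
def F (J₀ J : ℕ) (box : Finset (Idx S.d h Lb)) (p : Idx S.d h Lb → ℤ) (τ : Tau S.d)
    (z : ℚ_[S.p]) : ℚ_[S.p] :=
  ∑ u ∈ box, (p u : ℚ_[S.p]) * S.termF J₀ J u τ z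

/-- **`φ_{J,τ}(z) = ∑_{u ∈ box} p(u) · termΦ`**. [cite: CijsouwWaldschmidt1977, §4 (p. 186)] -/
def Φ (J₀ J : ℕ) (box : Finset (Idx S.d h Lb)) (p : Idx S.d h Lb → ℤ) (τ : Tau S.d)
    (z : ℚ_[S.p]) : ℚ_[S.p] :=
  ∑ u ∈ box, (p u : ℚ_[S.p]) * S.termΦ J₀ J u τ z

/-! ### The values of `φ` at natural numbers -/

/-- `termΦ(s) = qTerm` at a natural number `s`. [cite: CijsouwWaldschmidt1977, §4 (p. 188)] -/
theorem termΦ_natCast (J₀ J : ℕ) (u : Idx S.d h Lb) (τ : Tau S.d) (s : ℕ) :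
    S.termΦ J₀ J u τ (s : ℚ_[S.p]) = (S.qTerm J₀ J u τ s : ℚ_[S.p]) := by
  unfold termΦ qTerm
  rw [S.Dw_natCast, S.A_eq, S.exp_ψ_natCast]
  push_cast; ring

/-- **`φ_{J,τ}(s) = coreSum`** at a natural number `s` (a rational number).
[cite: CijsouwWaldschmidt1977, §4 (p. 188)] -/
theorem Φ_natCast (J₀ J : ℕ) (box : Finset (Idx S.d h Lb)) (p : Idx S.d h Lb → ℤ) (τ : Tau S.d)
    (s : ℕ) : S.Φ J₀ J box p τ (s : ℚ_[S.p]) = (S.coreSum J₀ J box p τ s : ℚ_[S.p]) := by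
  unfold Φ coreSum
  push_cast
  exact sum_congr rfl fun u _ => by rw [S.termΦ_natCast]

/-! ### Analyticity and the differential equations on `‖z‖ < √p` -/

/-- `‖√p‖`-facts: `0 < √p` and `(√p)⁻¹ · √p = 1`. [cite: CijsouwWaldschmidt1977, §4 (pp. 186–188)] -/
theorem sqrt_p_pos : 0 < Real.sqrt S.p := Real.sqrt_pos.mpr (by exact_mod_cast S.hp.pos)

/-- For `‖z‖ < √p` and `‖c‖ ≤ p⁻¹`, the point `c z` lies in the disc of convergence of `exp`.
[cite: Yu1990, §1.1] -/
theorem mem_eball_of_norm_lt {c z : ℚ_[S.p]} (hc : ‖c‖ ≤ (S.p : ℝ)⁻¹) (hz : ‖z‖ < Real.sqrt S.p) :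
    z • c ∈ eball (0 : ℚ_[S.p]) (expSeries ℚ_[S.p] ℚ_[S.p]).radius := by
  have hp0 : (0 : ℝ) < S.p := by exact_mod_cast S.hp.pos
  rw [mem_eball_zero_iff]
  refine lt_of_lt_of_le ?_ (PadicExp.inv_sqrt_le_expSeries_radius (ℓ := S.p) S.hp3)
  rw [enorm_eq_nnnorm, ENNReal.coe_lt_coe, ← NNReal.coe_lt_coe, coe_nnnorm, NNReal.coe_inv,
    Real.coe_sqrt, NNReal.coe_natCast, smul_eq_mul, norm_mul]
  calc ‖z‖ * ‖c‖ ≤ ‖z‖ * (S.p : ℝ)⁻¹ := mul_le_mul_of_nonneg_left hc (norm_nonneg _)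
    _ < Real.sqrt S.p * (S.p : ℝ)⁻¹ := mul_lt_mul_of_pos_right hz (by positivity)
    _ = (Real.sqrt S.p)⁻¹ := by
        refine eq_inv_of_mul_eq_one_left ?_
        rw [mul_right_comm, Real.mul_self_sqrt hp0.le, mul_inv_cancel₀ hp0.ne']

/-- `d/dz exp(c z) = c exp(c z)` for `‖c‖ ≤ p⁻¹`, `‖z‖ < √p`. [cite: Yu1990, §1.1] -/
theorem hasDerivAt_exp_mul {c z : ℚ_[S.p]} (hc : ‖c‖ ≤ (S.p : ℝ)⁻¹) (hz : ‖z‖ < Real.sqrt S.p) :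
    HasDerivAt (fun x : ℚ_[S.p] => exp (c * x)) (c * exp (c * z)) z := by
  have hd := hasDerivAt_exp_smul_const_of_mem_ball' (𝕂 := ℚ_[S.p]) c z (S.mem_eball_of_norm_lt hc hz)
  have e1 : (fun u : ℚ_[S.p] => exp (u • c)) = fun u : ℚ_[S.p] => exp (c * u) := by
    funext u; rw [smul_eq_mul, mul_comm]
  rw [e1, smul_eq_mul, mul_comm z c] at hd
  exact hd

/-- `z ↦ exp(c z)` is analytic at `z` for `‖c‖ ≤ p⁻¹`, `‖z‖ < √p`. [cite: Yu1990, §1.1] -/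
theorem analyticAt_exp_mul {c z : ℚ_[S.p]} (hc : ‖c‖ ≤ (S.p : ℝ)⁻¹) (hz : ‖z‖ < Real.sqrt S.p) :
    AnalyticAt ℚ_[S.p] (fun x : ℚ_[S.p] => exp (c * x)) z := by
  have h1 : AnalyticAt ℚ_[S.p] (exp : ℚ_[S.p] → ℚ_[S.p]) (c * z) := by
    refine analyticAt_exp_of_mem_ball (c * z) ?_
    have := S.mem_eball_of_norm_lt hc hz
    rwa [smul_eq_mul, mul_comm] at this
  have h2 : AnalyticAt ℚ_[S.p] (fun x : ℚ_[S.p] => c * x) z := by fun_prop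
  exact h1.comp h2

/-- **The derivative of one term**: `d/dz termF_τ = termF_{τ+e₀} + ∑ⱼ (log_p αⱼ) · termF_{τ+eⱼ}`
on `‖z‖ < √p`. [cite: CijsouwWaldschmidt1977, §4 (p. 188), the differential equations] -/
theorem hasDerivAt_termF (J₀ J : ℕ) (u : Idx S.d h Lb) (τ : Tau S.d) {z : ℚ_[S.p]}
    (hz : ‖z‖ < Real.sqrt S.p) :
    HasDerivAt (S.termF J₀ J u τ)
      (S.termF J₀ J u (bump0 τ) z + ∑ j : Fin S.d, S.lg j * S.termF J₀ J u (bumpj τ j) z) z := by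
  have h1 := S.hasDerivAt_Dw J₀ J u τ.1 z
  have h2 : HasDerivAt (fun x => S.A u τ.2 * exp (S.expo u * x))
      (S.A u τ.2 * (S.expo u * exp (S.expo u * z))) z :=
    (S.hasDerivAt_exp_mul (S.norm_expo_le u) hz).const_mul _
  have hsplit : S.termF J₀ J u τ = fun x => S.Dw J₀ J u τ.1 x * (S.A u τ.2 * exp (S.expo u * x)) := by
    funext x; simp only [termF]; ring
  rw [hsplit]
  refine (h1.mul h2).congr_deriv ?_
  have er : ∀ j : Fin S.d, S.lg j * S.termF J₀ J u (bumpj τ j) z =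
      S.Dw J₀ J u τ.1 z * (S.A u τ.2 * exp (S.expo u * z)) * ((S.frame.γ u j : ℚ_[S.p]) * S.lg j) := by
    intro j
    simp only [termF, bumpj]
    rw [S.A_bump]
    ring
  simp_rw [er]
  rw [← mul_sum, ← S.expo_eq]
  simp only [termF, bump0]
  ring

/-- The coefficients of the differential equation: `1` in the `Δ`-direction, `log_p αⱼ` in the
direction of `αⱼ`; all of norm `≤ 1`. [cite: CijsouwWaldschmidt1977, §4 (p. 188)] -/
def dcoef (i : Fin (S.d + 1)) : ℚ_[S.p] := Fin.cases (1 : ℚ_[S.p]) (fun j => S.lg j) i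

/-- `dcoef 0 · z = z` (`dcoef 0 = 1`; stated multiplicatively — the bare form is the tree's
`CW77.Setup.dcoef_zero` over `ℂ`). [cite: CijsouwWaldschmidt1977, §4 (pp. 186–188)] -/
@[simp] theorem dcoef_zero_mul (z : ℚ_[S.p]) : S.dcoef 0 * z = z := one_mul z

/-- `dcoef (j+1) = log_p αⱼ`. [cite: CijsouwWaldschmidt1977, §4 (pp. 186–188)] -/
@[simp] theorem dcoef_succ (j : Fin S.d) : S.dcoef j.succ = S.lg j := rfl

/-- `‖dcoef i‖ ≤ 1`. [cite: CijsouwWaldschmidt1977, §4 (pp. 186–188)] -/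
theorem norm_dcoef_le (i : Fin (S.d + 1)) : ‖S.dcoef i‖ ≤ 1 := by
  refine Fin.cases ?_ (fun j => ?_) i
  · show ‖(1 : ℚ_[S.p])‖ ≤ 1
    simp
  · rw [S.dcoef_succ]
    exact (S.norm_lg_le j).trans (inv_le_one_of_one_le₀ S.one_lt_p.le)

/-- **`d/dz f_{J,τ} = ∑ᵢ cᵢ f_{J,τ+eᵢ}`** on `‖z‖ < √p`. [cite: CijsouwWaldschmidt1977, §4 (p. 188)] -/
theorem hasDerivAt_F (J₀ J : ℕ) (box : Finset (Idx S.d h Lb)) (p : Idx S.d h Lb → ℤ)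
    (τ : Tau S.d) {z : ℚ_[S.p]} (hz : ‖z‖ < Real.sqrt S.p) :
    HasDerivAt (S.F J₀ J box p τ) (∑ i : Fin (S.d + 1), S.dcoef i * S.F J₀ J box p (bumpτ τ i) z) z := by
  unfold F
  have h := HasDerivAt.fun_sum fun u (_ : u ∈ box) => (S.hasDerivAt_termF J₀ J u τ hz).const_mul (p u : ℚ_[S.p])
  refine h.congr_deriv ?_
  simp only [Fin.sum_univ_succ, dcoef_zero_mul, dcoef_succ, bumpτ_zero, bumpτ_succ, mul_add,
    sum_add_distrib, mul_sum]
  congr 1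
  rw [sum_comm]
  exact sum_congr rfl fun j _ => sum_congr rfl fun u _ => by ring

/-- `Dw` is smooth (a polynomial function). [cite: CijsouwWaldschmidt1977, §4 (pp. 186–188)] -/
theorem contDiffAt_Dw (J₀ J : ℕ) (u : Idx S.d h Lb) (τ₀ : ℕ) (n : WithTop ℕ∞) (z : ℚ_[S.p]) :
    ContDiffAt ℚ_[S.p] n (S.Dw J₀ J u τ₀) z := by
  have hc := (Polynomial.contDiff_aeval (𝕜 := ℚ_[S.p]) (derivative^[τ₀] (S.wOf J₀ J u)) n).contDiffAt
    (x := z)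
  have e : S.Dw J₀ J u τ₀ = fun x : ℚ_[S.p] => Polynomial.aeval x (derivative^[τ₀] (S.wOf J₀ J u)) := by
    funext x; unfold Dw; rw [Polynomial.coe_aeval_eq_eval]
  rw [e]; exact hc

/-- `f_{J,τ}` is smooth at every point of the disc `‖z‖ < √p`. [cite: CijsouwWaldschmidt1977, §4 (pp. 186–188)] -/
theorem contDiffAt_F (J₀ J : ℕ) (box : Finset (Idx S.d h Lb)) (p : Idx S.d h Lb → ℤ) (τ : Tau S.d)
    (n : WithTop ℕ∞) {z : ℚ_[S.p]} (hz : ‖z‖ < Real.sqrt S.p) :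
    ContDiffAt ℚ_[S.p] n (S.F J₀ J box p τ) z := by
  unfold F termF
  refine ContDiffAt.sum fun u _ => contDiffAt_const.mul ?_
  exact ((S.contDiffAt_Dw J₀ J u τ.1 n z).mul contDiffAt_const).mul
    (S.analyticAt_exp_mul (S.norm_expo_le u) hz).contDiffAt

/-- The disc `‖z‖ < √p` is a neighbourhood of each of its points. [cite: CijsouwWaldschmidt1977, §4 (pp. 186–188)] -/
theorem ball_sqrt_mem_nhds {a : ℚ_[S.p]} (ha : ‖a‖ < Real.sqrt S.p) :
    {z : ℚ_[S.p] | ‖z‖ < Real.sqrt S.p} ∈ 𝓝 a := by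
  have : {z : ℚ_[S.p] | ‖z‖ < Real.sqrt S.p} = Metric.ball 0 (Real.sqrt S.p) := by
    ext z; simp
  rw [this]
  exact Metric.isOpen_ball.mem_nhds (by simpa using ha)

/-- `deriv f_{J,τ} = ∑ᵢ cᵢ f_{J,τ+eᵢ}` near every point of `‖z‖ < √p`. [cite: CijsouwWaldschmidt1977, §4 (p. 188)] -/
theorem deriv_F_eventuallyEq (J₀ J : ℕ) (box : Finset (Idx S.d h Lb)) (p : Idx S.d h Lb → ℤ)
    (τ : Tau S.d) {a : ℚ_[S.p]} (ha : ‖a‖ < Real.sqrt S.p) :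
    deriv (S.F J₀ J box p τ) =ᶠ[𝓝 a] fun z => ∑ i : Fin (S.d + 1), S.dcoef i * S.F J₀ J box p (bumpτ τ i) z := by
  filter_upwards [S.ball_sqrt_mem_nhds ha] with z hz using (S.hasDerivAt_F J₀ J box p τ hz).deriv

/-- **The iterated derivatives**: `f_τ^{(k+1)}(a) = ∑ᵢ cᵢ f_{τ+eᵢ}^{(k)}(a)` (`‖a‖ < √p`).
[cite: CijsouwWaldschmidt1977, §4 (11) (p. 189)] -/
theorem iteratedDeriv_F_succ (J₀ J : ℕ) (box : Finset (Idx S.d h Lb)) (p : Idx S.d h Lb → ℤ)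
    (τ : Tau S.d) {a : ℚ_[S.p]} (ha : ‖a‖ < Real.sqrt S.p) (k : ℕ) :
    iteratedDeriv (k + 1) (S.F J₀ J box p τ) a =
      ∑ i : Fin (S.d + 1), S.dcoef i * iteratedDeriv k (S.F J₀ J box p (bumpτ τ i)) a := by
  rw [iteratedDeriv_succ', (S.deriv_F_eventuallyEq J₀ J box p τ ha).iteratedDeriv_eq k,
    iteratedDeriv_fun_sum fun i _ => contDiffAt_const.mul (S.contDiffAt_F J₀ J box p (bumpτ τ i) k ha)]
  refine sum_congr rfl fun i _ => ?_
  exact iteratedDeriv_const_mul _ (S.contDiffAt_F J₀ J box p (bumpτ τ i) k ha)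

/-- **Derivatives are controlled by values, without loss** (ultrametric form of (10) ⇒ (11),
pp. 188–189): if `‖f_{J,τ'}(a)‖ ≤ ε` whenever `|τ'| ≤ N`, then `‖f_{J,τ}^{(k)}(a)‖ ≤ ε` whenever
`|τ| + k ≤ N` (`‖a‖ < √p`; the coefficients `1, log_p αⱼ` have norm `≤ 1`).
[cite: CijsouwWaldschmidt1977, §4 (11) (p. 189)] [cite: Yu1990, Lemma 2.4] -/
theorem norm_iteratedDeriv_F_le_of_forall (J₀ J : ℕ) (box : Finset (Idx S.d h Lb))
    (p : Idx S.d h Lb → ℤ) {a : ℚ_[S.p]} (ha : ‖a‖ < Real.sqrt S.p) (N : ℕ) {ε : ℝ} (hε0 : 0 ≤ ε)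
    (hε : ∀ τ : Tau S.d, tauNorm τ ≤ N → ‖S.F J₀ J box p τ a‖ ≤ ε) :
    ∀ (k : ℕ) (τ : Tau S.d), tauNorm τ + k ≤ N → ‖iteratedDeriv k (S.F J₀ J box p τ) a‖ ≤ ε := by
  intro k
  induction k with
  | zero => intro τ hτ; simpa using hε τ (by simpa using hτ)
  | succ k ih =>
    intro τ hτ
    rw [S.iteratedDeriv_F_succ J₀ J box p τ ha k]
    refine IsUltrametricDist.norm_sum_le_of_forall_le_of_nonneg hε0 fun i _ => ?_
    rw [norm_mul]
    refine (mul_le_of_le_one_left (norm_nonneg _) (S.norm_dcoef_le i)).trans (ih _ ?_)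
    rw [tauNorm_bumpτ]; omega

/-! ### Sizes on the unit disc, and Lemma 9 -/

/-- **Size of `f_{J,τ}` on the unit disc**: `‖f_{J,τ}(z)‖ ≤ Q` if `‖Dw(u,τ₀,z)‖ ≤ Q` on the box
(`p(u) ∈ ℤ`, `‖A‖ ≤ 1`, `‖exp(expo z)‖ = 1`). [cite: Yu1990, Lemma 2.2] -/
theorem norm_F_le (J₀ J : ℕ) (box : Finset (Idx S.d h Lb)) (p : Idx S.d h Lb → ℤ) (τ : Tau S.d)
    {z : ℚ_[S.p]} (hz : ‖z‖ ≤ 1) {Q : ℝ} (hQ0 : 0 ≤ Q)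
    (hQ : ∀ u ∈ box, ‖S.Dw J₀ J u τ.1 z‖ ≤ Q) : ‖S.F J₀ J box p τ z‖ ≤ Q := by
  unfold F
  refine IsUltrametricDist.norm_sum_le_of_forall_le_of_nonneg hQ0 fun u hu => ?_
  have hez : ‖S.expo u * z‖ ≤ (S.p : ℝ)⁻¹ := by
    rw [norm_mul]
    exact (mul_le_of_le_one_right (norm_nonneg _) hz).trans (S.norm_expo_le u)
  rw [norm_mul, termF, norm_mul, norm_mul, PadicExp.norm_exp_of_norm_le S.hp3 hez, mul_one]
  calc ‖(p u : ℚ_[S.p])‖ * (‖S.Dw J₀ J u τ.1 z‖ * ‖S.A u τ.2‖)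
      ≤ 1 * (Q * 1) := by
        refine mul_le_mul (Padic.norm_int_le_one _) ?_ (by positivity) zero_le_one
        exact mul_le_mul (hQ u hu) (S.norm_A_le u τ.2) (norm_nonneg _) hQ0
    _ = Q := by ring

/-- **Lemma 9, ultrametric**: on the unit disc, if `‖Λ₀‖ ≤ p⁻¹` then
`‖f_{J,τ}(z) − φ_{J,τ}(z)‖ ≤ Q · ‖Λ₀‖` (`Q ≥ ‖Dw‖` on the box), because
`termF − termΦ = Dw · A · exp(ψ z) · (exp(λ_θ Λ₀ z) − 1)` and `‖exp w − 1‖ = ‖w‖ ≤ ‖Λ₀‖`.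
[cite: CijsouwWaldschmidt1977, §4 Lemma 9 (p. 187)] [cite: Yu1990, Lemma 2.3] -/
theorem norm_F_sub_Φ_le (J₀ J : ℕ) (box : Finset (Idx S.d h Lb)) (p : Idx S.d h Lb → ℤ)
    (τ : Tau S.d) (hΛ : ‖S.Λ₀‖ ≤ (S.p : ℝ)⁻¹) {z : ℚ_[S.p]} (hz : ‖z‖ ≤ 1) {Q : ℝ} (hQ0 : 0 ≤ Q)
    (hQ : ∀ u ∈ box, ‖S.Dw J₀ J u τ.1 z‖ ≤ Q) :
    ‖S.F J₀ J box p τ z - S.Φ J₀ J box p τ z‖ ≤ Q * ‖S.Λ₀‖ := by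
  unfold F Φ
  rw [← sum_sub_distrib]
  refine IsUltrametricDist.norm_sum_le_of_forall_le_of_nonneg (by positivity) fun u hu => ?_
  have hψz : ‖S.ψ u * z‖ ≤ (S.p : ℝ)⁻¹ := by
    rw [norm_mul]; exact (mul_le_of_le_one_right (norm_nonneg _) hz).trans (S.norm_ψ_le u)
  have hδ : ‖(u.2.2 : ℚ_[S.p]) * S.Λ₀ * z‖ ≤ ‖S.Λ₀‖ := by
    rw [norm_mul]; exact (mul_le_of_le_one_right (norm_nonneg _) hz).trans (S.norm_natCast_mul_Λ₀_le _)
  have hδ' : ‖(u.2.2 : ℚ_[S.p]) * S.Λ₀ * z‖ ≤ (S.p : ℝ)⁻¹ := hδ.trans hΛ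
  have e : (p u : ℚ_[S.p]) * S.termF J₀ J u τ z - (p u : ℚ_[S.p]) * S.termΦ J₀ J u τ z =
      (p u : ℚ_[S.p]) * (S.Dw J₀ J u τ.1 z * S.A u τ.2 * exp (S.ψ u * z)) *
        (exp ((u.2.2 : ℚ_[S.p]) * S.Λ₀ * z) - 1) := by
    simp only [termF, termΦ, expo]
    rw [show (S.ψ u + (u.2.2 : ℚ_[S.p]) * S.Λ₀) * z = S.ψ u * z + (u.2.2 : ℚ_[S.p]) * S.Λ₀ * z by ring,
      PadicExp.exp_add_of_norm_le S.hp3 hψz hδ']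
    ring
  rw [e, norm_mul, norm_mul, norm_mul, norm_mul, PadicExp.norm_exp_of_norm_le S.hp3 hψz, mul_one,
    PadicExp.norm_exp_sub_one_of_norm_le S.hp3 hδ']
  calc ‖(p u : ℚ_[S.p])‖ * (‖S.Dw J₀ J u τ.1 z‖ * ‖S.A u τ.2‖) * ‖(u.2.2 : ℚ_[S.p]) * S.Λ₀ * z‖
      ≤ 1 * (Q * 1) * ‖S.Λ₀‖ := by
        refine mul_le_mul ?_ hδ (norm_nonneg _) (by positivity)
        refine mul_le_mul (Padic.norm_int_le_one _) ?_ (by positivity) zero_le_one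
        exact mul_le_mul (hQ u hu) (S.norm_A_le u τ.2) (norm_nonneg _) hQ0
    _ = Q * ‖S.Λ₀‖ := by ring

end Setup

end PadicCW77

end Literature.NumberTheory.Transcendental

end
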